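import Mathlib.Data.ZMod.Units
import Mathlib.Data.Nat.Squarefree
import Mathlib.Algebra.BigOperators.Ring.Finset
import Mathlib.Algebra.BigOperators.Fin
import Mathlib.Logic.Function.Iterate
import Mathlib.Tactic.FieldSimp
import Mathlib.Tactic.LinearCombination
import Mathlib.Tactic.Ring
import Mathlib.Tactic.Positivity
import HarnessLib

/-!
# The functional equation of Mazur–Tate elements read on Kurihara sums

Topic `NumberTheory/EllipticCurves`; namespace `Literature.NumberTheory.EllipticCurves.MazurTate` (the
sub-namespace of `MazurTateElementKuriharaCoefficient` for group-ring / Taylor-coefficient generalities).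
PROVED theorems only (no definitions, no named facts): the elementary algebra behind

* C.-H. Kim, *Amer. J. Math.* 148 (2026), §3.5, eq. (3.3) and Prop. 3.14 (journal; = arXiv:2203.12159v3
  Prop. 3.16): "`w(E)·(−1)^{ν(n)}·δ̃_n = δ̃_n ∈ ℤ_p/I_nℤ_p` … If `(−1)^{ν(n)} ≠ w(E)`, then `δ̃_n = 0`",
  derived there "following [Kurihara 2012] and [Kurihara–Münster]" from the functional equation of the
  Mazur–Tate modular elements (Mazur–Tate 1987, (1.6.2): `θ^ι = w σ_{−N} θ`, `ι : σ ↦ σ⁻¹`) and their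
  norm (Hecke) relations;
* M. Kurihara, *Contrib. Math. Comput. Sci.* 7 (2014), Lemma 5.2.1 ("By the functional equation (1.6.2)
  in Mazur and Tate … `ε(−1)^{ε(m)} δ̃_m ≡ δ̃_m (mod p)`");
* C.-H. Kim, arXiv:2505.09121v1, Prop. 2.5 / eq. (2.1) (the same for newforms of any weight).

The printed proofs use three properties of the modular symbols `λ(r) = [r]⁺` reduced modulo `p^k`:
(P) `λ(r + 1) = λ(r)`; (H) the Hecke / norm relation `a_ℓ λ(v/d) = Σ_{j mod ℓ} λ((v/d + j)/ℓ) + λ(ℓv/d)`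
at the Kolyvagin primes `ℓ ∣ n` (where `a_ℓ ≡ ℓ + 1 ≡ 2`); (F) the Fricke / Atkin–Lehner symmetry
`λ(u/n) = w·λ(v/n)` for `uNv ≡ −1 (mod n)`. This file proves their consequences for an ABSTRACT symbol
`Λ : ℚ → R` (any commutative ring `R`) and an abstract compatible family of additive characters
`χ d ℓ : (ℤ/d)ˣ → R` (in the application, `χ d ℓ = log_{η_ℓ} ∘ (a ↦ a mod ℓ)`), with (P), (H), (F) as
hypotheses; the companion `KuriharaNumberParityProofs` instantiates `R = ℤ/p^k`, `Λ = \overline{[·]⁺_f}`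
for the newform `f` of an elliptic curve and deduces the named fact
`Kim2022_kuriharaNumber_eq_zero_of_neg_one_pow_ne_rootNumber` (file `KuriharaNumberParity`) modulo
modularity, and unconditionally in the Fricke-sign currency.

## Notation of the docstrings

For a level `d ≥ 1` and a finite set `T` of primes, the **partial Kurihara sum** is
`D_d(T) = Σ_{b ∈ (ℤ/d)ˣ} Λ(b.val/d) · Π_{q ∈ T} χ_d,q(b)` (written out in every statement; the sums
are indexed by the units `(ℤ/d)ˣ` with representatives `b.val ∈ [0, d)` exactly as the tree's
`kuriharaNumber`, file `KuriharaNumber.lean`, so that the instantiation is definitional). For `T` the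
set of all primes of `d` this is the Kurihara number `δ_d` (Kurihara 2014, §1.1 (2); Kim 2022, §1.4.3);
for smaller `T` it is a lower Taylor coefficient of the Mazur–Tate element `θ_{ℚ(μ_d)} = Σ_a [a/d]⁺σ_a`
(Ota 2018, Prop. 3.3; the tree's `MazurTate.taylorCoeff`). The twisted sums are
`E_d(T; w) = Σ_y Λ((wy).val/d) Π_{q ∈ T} χ_d,q(y)` for `w ∈ (ℤ/d)ˣ`.

## Contents (all proved)

* (private `symbol_intCast_eq`, `symbol_natCast_eq` — (P) makes `Λ(z/d)` depend on `z mod d` only.)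
* `sum_fiber_symbol_eq` — the **norm relation** read coefficientwise (Mazur–Tate 1987, §1.3; Ota 2018,
  Prop. 2.3 (1)): `Σ_{b ≡ x (m), b ∈ (ℤ/ℓm)ˣ} Λ(b/ℓm) = a_ℓ Λ(x/m) − Λ(ℓx/m) − Λ(ℓ⁻¹x/m)`, from (P), (H).
* `twistedSum_eq_sum_powerset` — `E_d(T; w) = Σ_{t ⊆ T} (Π_{T∖t} −χ_q(w)) D_d(t)` (additivity of the
  characters); hence (private `twistedSum_eq_of_lower_eq_zero`) `E_d(T; w) = D_d(T)` once the lower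
  sums vanish.
* `kuriharaSum_mul_level_eq` — `D_{ℓm}(T) = a_ℓ D_m(T) − E_m(T; ℓ) − E_m(T; ℓ⁻¹)` for `T ⊆ primes(m)`.
* `kuriharaSum_eq_zero_of_ssubset` — **the lower Taylor coefficients vanish**: if `a_ℓ = 2` in `R`
  for every prime `ℓ ∣ n` (`n` square-free), then `D_d(T) = 0` for all `d ∣ n` and `T ⊊ primes(d)`
  (induction on `d`: `D_{ℓm}(T) = (a_ℓ − 2) D_m(T) − Σ_{t ⊊ T} (…) D_m(t)`). Only the congruence
  `a_ℓ ≡ 2` is used, not `ℓ ≡ 1` (the latter is what makes surjective `χ_ℓ` exist).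
* `kuriharaSum_primeFactors_eq_sign_mul` — **the functional equation (3.3)**: under (F) with sign `σ`,
  `δ_n = σ·(−1)^{ν(n)}·δ_n` (reindex `b ↦ (−N)⁻¹b⁻¹`, expand `Π_ℓ (χ_ℓ((−N)⁻¹) − χ_ℓ(b))`, lower terms
  vanish); `kuriharaSum_primeFactors_eq_zero` — if `σ(−1)^{ν(n)} = −1` and `2 ∈ Rˣ` then `δ_n = 0`.

The CRT fibre `{b ∈ (ℤ/ℓm)ˣ : b ≡ x (m)} = {x + mj : 0 ≤ j < ℓ, ℓ ∤ x + mj}` is handled on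
representatives. Not here: modular symbols, `p`-adic reduction, root numbers
(see `KuriharaNumberParityProofs`).

## References
* [MazurTate1987] B. Mazur, J. Tate, Duke Math. J. 54 (1987) 711–750, §1.3 (norm compatibility),
  (1.6.2) (functional equation).
* [Kim2022StructureSelmer] C.-H. Kim, Amer. J. Math. 148 (2026) = arXiv:2203.12159, §3.5 eq. (3.3),
  Prop. 3.14 (journal) = Prop. 3.16 (arXiv v3).
* [Kurihara2014] M. Kurihara, Contrib. Math. Comput. Sci. 7 (2014), §1.1 (1)–(2), Lemma 5.2.1.
* [Ota2018] K. Ota, Amer. J. Math. 140 (2018), Prop. 2.3 (1), Prop. 3.3.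
-/

noncomputable section

open scoped BigOperators

namespace Literature.NumberTheory.EllipticCurves.MazurTate

variable {R : Type*} [CommRing R] {Λ : ℚ → R}

/-! ### (P): a `1`-periodic symbol factors through `ℤ/d` -/

section Periodic

omit [CommRing R] in
/-- If `Λ(r + z) = Λ(r)` for `z ∈ ℤ`, then `Λ(z/d)` only depends on `z mod d`: with `y = z mod d ∈ ℤ/d`
and its representative `y.val ∈ [0, d)`, `Λ(y.val/d) = Λ(z/d)`. [folklore] -/
private theorem symbol_intCast_eq (hP : ∀ (r : ℚ) (z : ℤ), Λ (r + z) = Λ r) (d : ℕ) [NeZero d] (z : ℤ) :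
    Λ ((((z : ZMod d)).val : ℚ) / d) = Λ ((z : ℚ) / d) := by
  have hd : (d : ℚ) ≠ 0 := by exact_mod_cast NeZero.ne d
  have h1 : ((((z : ZMod d)).val : ℕ) : ℚ) = ((z % (d : ℤ) : ℤ) : ℚ) := by
    exact_mod_cast ZMod.val_intCast z
  have h2' : z = z % (d : ℤ) + (d : ℤ) * (z / (d : ℤ)) := (Int.emod_add_mul_ediv z d).symm
  have h2 : (z : ℚ) = ((z % (d : ℤ) : ℤ) : ℚ) + (d : ℚ) * ((z / (d : ℤ) : ℤ) : ℚ) := by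
    exact_mod_cast h2'
  rw [h1, h2, add_div, mul_div_cancel_left₀ _ hd, hP]

omit [CommRing R] in
/-- Natural-number form of `symbol_intCast_eq`: `Λ((v mod d).val/d) = Λ(v/d)`. [folklore] -/
private theorem symbol_natCast_eq (hP : ∀ (r : ℚ) (z : ℤ), Λ (r + z) = Λ r) (d : ℕ) [NeZero d] (v : ℕ) :
    Λ ((((v : ZMod d)).val : ℚ) / d) = Λ ((v : ℚ) / d) := by
  have h := symbol_intCast_eq hP d (v : ℤ)
  push_cast at h
  exact h

end Periodic

/-! ### (H): the norm relation on the fibres of `(ℤ/ℓm)ˣ → (ℤ/m)ˣ` -/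

section Fiber

variable {ℓ m : ℕ} [NeZero m] [NeZero (ℓ * m)]

omit [NeZero m] in
/-- An element `b ∈ (ℤ/ℓm)ˣ` over `x ∈ (ℤ/m)ˣ` has representative `b.val = x.val + m·⌊b.val/m⌋`.
[folklore] -/
private theorem val_eq_of_unitsMap_eq {x : (ZMod m)ˣ} {b : (ZMod (ℓ * m))ˣ}
    (hb : ZMod.unitsMap (dvd_mul_left m ℓ) b = x) :
    (b : ZMod (ℓ * m)).val = (x : ZMod m).val + m * ((b : ZMod (ℓ * m)).val / m) := by
  have hx : (((b : ZMod (ℓ * m)).val : ℕ) : ZMod m) = (x : ZMod m) := by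
    rw [← hb, ZMod.unitsMap_val, ZMod.cast_eq_val]
  have hmod : (b : ZMod (ℓ * m)).val % m = (x : ZMod m).val := by
    have h := congrArg ZMod.val hx
    rwa [ZMod.val_natCast] at h
  calc (b : ZMod (ℓ * m)).val
      = (b : ZMod (ℓ * m)).val % m + m * ((b : ZMod (ℓ * m)).val / m) := (Nat.mod_add_div _ _).symm
    _ = (x : ZMod m).val + m * ((b : ZMod (ℓ * m)).val / m) := by rw [hmod]

omit [NeZero m] [NeZero (ℓ * m)] in
/-- A unit of `ℤ/ℓm` has representative prime to `ℓ` (`ℓ` prime). [folklore] -/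
private theorem not_dvd_val_of_unit (hℓ : ℓ.Prime) (b : (ZMod (ℓ * m))ˣ) :
    ¬ ℓ ∣ (b : ZMod (ℓ * m)).val := by
  intro h
  have h1 : ℓ ∣ Nat.gcd (b : ZMod (ℓ * m)).val (ℓ * m) := Nat.dvd_gcd h (dvd_mul_right ℓ m)
  rw [(ZMod.val_coe_unit_coprime b).gcd_eq_one] at h1
  exact hℓ.one_lt.ne' (Nat.dvd_one.mp h1)

/-- **The norm relation, coefficientwise** (Mazur–Tate 1987, §1.3; Ota 2018, Prop. 2.3 (1):
`π_{ℓm → m} θ_{ℓm} = (a_ℓ − σ_ℓ − σ_ℓ⁻¹) θ_m`). Let `ℓ` be a prime not dividing `m`, `Λ` a `1`-periodic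
symbol satisfying the Hecke relation `a Λ(v/m) = Σ_{j mod ℓ} Λ((v/m + j)/ℓ) + Λ(ℓ v/m)` at level `m`,
and `u = ℓ ∈ (ℤ/m)ˣ`. Then for every `x ∈ (ℤ/m)ˣ` the sum of `Λ(b.val/ℓm)` over the units `b ∈ (ℤ/ℓm)ˣ`
with `b ≡ x (mod m)` equals `a Λ(x/m) − Λ((ℓx)/m) − Λ((ℓ⁻¹x)/m)`: the residues `x + mj`, `0 ≤ j < ℓ`,
above `x` are these units together with the single multiple `ℓc` of `ℓ`, `c ≡ ℓ⁻¹x (mod m)`.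
[cite: MazurTate1987, §1.3] -/
theorem sum_fiber_symbol_eq (hP : ∀ (r : ℚ) (z : ℤ), Λ (r + z) = Λ r) (hℓ : ℓ.Prime)
    (hℓm : ¬ ℓ ∣ m) (a : R)
    (hH : ∀ v : ℤ, a * Λ ((v : ℚ) / m) =
      ∑ j : Fin ℓ, Λ (((v : ℚ) / m + ((j : ℕ) : ℚ)) / ℓ) + Λ ((ℓ : ℚ) * ((v : ℚ) / m)))
    (u : (ZMod m)ˣ) (hu : (u : ZMod m) = ℓ) (x : (ZMod m)ˣ) :
    ∑ b ∈ Finset.univ.filter (fun b : (ZMod (ℓ * m))ˣ => ZMod.unitsMap (dvd_mul_left m ℓ) b = x),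
        Λ (((b : ZMod (ℓ * m)).val : ℚ) / ((ℓ * m : ℕ) : ℚ)) =
      a * Λ (((x : ZMod m).val : ℚ) / m) - Λ ((((u * x : (ZMod m)ˣ) : ZMod m).val : ℚ) / m)
        - Λ ((((u⁻¹ * x : (ZMod m)ˣ) : ZMod m).val : ℚ) / m) := by
  classical
  have hm0 : 0 < m := Nat.pos_of_ne_zero (NeZero.ne m)
  haveI : NeZero ℓ := ⟨hℓ.ne_zero⟩
  have hmq : (m : ℚ) ≠ 0 := by exact_mod_cast hm0.ne'
  have hℓq : (ℓ : ℚ) ≠ 0 := by exact_mod_cast hℓ.ne_zero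
  have hcopm : Nat.Coprime m ℓ := ((Nat.Prime.coprime_iff_not_dvd hℓ).mpr hℓm).symm
  have hxm : (x : ZMod m).val < m := ZMod.val_lt _
  -- the residues `x + m j`, `j < ℓ`, at level `ℓm`
  obtain ⟨S, hS⟩ : ∃ S : Fin ℓ → R, ∀ j : Fin ℓ, S j =
      Λ ((((((x : ZMod m).val + m * (j : ℕ) : ℕ)) : ZMod (ℓ * m)).val : ℚ) / ((ℓ * m : ℕ) : ℚ)) :=
    ⟨_, fun _ => rfl⟩
  have hlt : ∀ j : Fin ℓ, (x : ZMod m).val + m * (j : ℕ) < ℓ * m := fun j =>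
    calc (x : ZMod m).val + m * (j : ℕ) < m + m * (j : ℕ) := Nat.add_lt_add_right hxm _
      _ = m * ((j : ℕ) + 1) := by ring
      _ ≤ m * ℓ := Nat.mul_le_mul_left m j.isLt
      _ = ℓ * m := mul_comm _ _
  -- the Hecke relation at `v = x.val`, through the level-`m` and level-`ℓm` representatives
  have e1 : Λ ((ℓ : ℚ) * ((((x : ZMod m).val : ℚ)) / m)) =
      Λ ((((u * x : (ZMod m)ˣ) : ZMod m).val : ℚ) / m) := by
    have h : ((u * x : (ZMod m)ˣ) : ZMod m) = ((ℓ * (x : ZMod m).val : ℕ) : ZMod m) := by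
      rw [Units.val_mul, hu, Nat.cast_mul, ZMod.natCast_zmod_val]
    rw [h, symbol_natCast_eq hP, Nat.cast_mul, mul_div_assoc]
  have e2 : ∀ j : Fin ℓ, Λ (((((x : ZMod m).val : ℚ)) / m + ((j : ℕ) : ℚ)) / ℓ) = S j := by
    intro j
    rw [hS, symbol_natCast_eq hP]
    congr 1
    push_cast
    field_simp
  have hHx := hH ((x : ZMod m).val : ℤ)
  push_cast at hHx
  rw [e1, Finset.sum_congr rfl (fun j _ => e2 j)] at hHx
  -- split the `j`-sum into the units above `x` and the single non-unit
  have hsplit := Finset.sum_filter_add_sum_filter_not (Finset.univ : Finset (Fin ℓ))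
    (fun j : Fin ℓ => ℓ ∣ (x : ZMod m).val + m * (j : ℕ)) S
  -- the non-unit: `x.val + m j₀ = ℓ c` with `c ≡ ℓ⁻¹ x (mod m)`
  have hmm : (m : ZMod ℓ) * (m : ZMod ℓ)⁻¹ = 1 := ZMod.coe_mul_inv_eq_one m hcopm
  obtain ⟨t, ht⟩ : ∃ t : ZMod ℓ, t = -((((x : ZMod m).val : ZMod ℓ)) * (m : ZMod ℓ)⁻¹) := ⟨_, rfl⟩
  have hkey : ∀ j : Fin ℓ, ℓ ∣ (x : ZMod m).val + m * (j : ℕ) ↔ ((j : ℕ) : ZMod ℓ) = t := by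
    intro j
    rw [← ZMod.natCast_eq_zero_iff]
    push_cast
    constructor
    · intro h0
      linear_combination (m : ZMod ℓ)⁻¹ * h0 - ((j : ℕ) : ZMod ℓ) * hmm - ht
    · intro hj
      rw [hj, ht]
      linear_combination (-(((x : ZMod m).val : ZMod ℓ))) * hmm
  have hbad : ∑ j ∈ Finset.univ.filter (fun j : Fin ℓ => ℓ ∣ (x : ZMod m).val + m * (j : ℕ)), S j =
      Λ ((((u⁻¹ * x : (ZMod m)ˣ) : ZMod m).val : ℚ) / m) := by
    have hj₀ : ℓ ∣ (x : ZMod m).val + m * ((⟨t.val, ZMod.val_lt t⟩ : Fin ℓ) : ℕ) := by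
      rw [hkey]
      exact ZMod.natCast_zmod_val t
    have hsingle : Finset.univ.filter (fun j : Fin ℓ => ℓ ∣ (x : ZMod m).val + m * (j : ℕ)) =
        {(⟨t.val, ZMod.val_lt t⟩ : Fin ℓ)} := by
      refine Finset.eq_singleton_iff_unique_mem.mpr ⟨?_, fun j hj => ?_⟩
      · exact Finset.mem_filter.mpr ⟨Finset.mem_univ _, hj₀⟩
      · have hj' := (hkey j).mp (Finset.mem_filter.mp hj).2
        apply Fin.ext
        have hv := congrArg ZMod.val hj'
        rw [ZMod.val_natCast_of_lt j.isLt] at hv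
        exact hv
    rw [hsingle, Finset.sum_singleton, hS]
    obtain ⟨c, hc⟩ := hj₀
    have hcm : (x : ZMod m) = (u : ZMod m) * (c : ZMod m) := by
      have h := congrArg (Nat.cast : ℕ → ZMod m) hc
      simp only [Nat.cast_add, Nat.cast_mul, ZMod.natCast_zmod_val, ZMod.natCast_self, zero_mul,
        add_zero] at h
      rw [← hu] at h
      exact h
    have hux : ((u⁻¹ * x : (ZMod m)ˣ) : ZMod m) = (c : ZMod m) := by
      rw [Units.val_mul, hcm, ← mul_assoc, Units.inv_mul, one_mul]
    rw [hc, hux, symbol_natCast_eq hP, symbol_natCast_eq hP]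
    congr 1
    push_cast
    exact mul_div_mul_left (c : ℚ) (m : ℚ) hℓq
  -- the units above `x`: `b ↦ ⌊b.val / m⌋` is a bijection onto `{j : ℓ ∤ x.val + m j}`
  have hfib : ∑ b ∈ Finset.univ.filter
        (fun b : (ZMod (ℓ * m))ˣ => ZMod.unitsMap (dvd_mul_left m ℓ) b = x),
        Λ (((b : ZMod (ℓ * m)).val : ℚ) / ((ℓ * m : ℕ) : ℚ)) =
      ∑ j ∈ Finset.univ.filter (fun j : Fin ℓ => ¬ ℓ ∣ (x : ZMod m).val + m * (j : ℕ)), S j := by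
    refine Finset.sum_bij
      (fun b _ => (⟨(b : ZMod (ℓ * m)).val / m, Nat.div_lt_of_lt_mul
        (lt_of_lt_of_eq (ZMod.val_lt _) (mul_comm ℓ m))⟩ : Fin ℓ)) ?_ ?_ ?_ ?_
    · intro b hb
      have hb' := (Finset.mem_filter.mp hb).2
      refine Finset.mem_filter.mpr ⟨Finset.mem_univ _, ?_⟩
      simp only
      rw [← val_eq_of_unitsMap_eq hb']
      exact not_dvd_val_of_unit hℓ b
    · intro b₁ hb₁ b₂ hb₂ h
      have hq : (b₁ : ZMod (ℓ * m)).val / m = (b₂ : ZMod (ℓ * m)).val / m := by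
        simpa using congrArg Fin.val h
      apply Units.ext
      apply ZMod.val_injective (ℓ * m)
      rw [val_eq_of_unitsMap_eq (Finset.mem_filter.mp hb₁).2,
        val_eq_of_unitsMap_eq (Finset.mem_filter.mp hb₂).2, hq]
    · intro j hj
      have hj' := (Finset.mem_filter.mp hj).2
      have hcop : Nat.Coprime ((x : ZMod m).val + m * (j : ℕ)) (ℓ * m) := by
        refine Nat.Coprime.mul_right ?_ ?_
        · exact ((Nat.Prime.coprime_iff_not_dvd hℓ).mpr hj').symm
        · rw [Nat.coprime_add_mul_left_left]
          exact ZMod.val_coe_unit_coprime x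
      have hval : ((ZMod.unitOfCoprime _ hcop : (ZMod (ℓ * m))ˣ) : ZMod (ℓ * m)).val =
          (x : ZMod m).val + m * (j : ℕ) := by
        rw [ZMod.coe_unitOfCoprime, ZMod.val_natCast_of_lt (hlt j)]
      refine ⟨ZMod.unitOfCoprime _ hcop, Finset.mem_filter.mpr ⟨Finset.mem_univ _, ?_⟩, ?_⟩
      · apply Units.ext
        rw [ZMod.unitsMap_val, ZMod.coe_unitOfCoprime, ZMod.cast_natCast (dvd_mul_left m ℓ),
          Nat.cast_add, Nat.cast_mul, ZMod.natCast_zmod_val, ZMod.natCast_self, zero_mul, add_zero]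
      · apply Fin.ext
        simp only
        rw [hval, Nat.add_mul_div_left _ _ hm0, Nat.div_eq_of_lt hxm, zero_add]
    · intro b hb
      have hb' := (Finset.mem_filter.mp hb).2
      rw [hS]
      simp only
      rw [← val_eq_of_unitsMap_eq hb', ZMod.natCast_zmod_val]
  linear_combination -hHx + hsplit - hbad + hfib

/-- **Expansion of the twisted sums.** For a unit `w ∈ (ℤ/d)ˣ`, a finite set `T` of primes and
additive characters `χ_q = χ d q : (ℤ/d)ˣ → R`,
`Σ_y Λ((wy).val/d) Π_{q ∈ T} χ_q(y) = Σ_{t ⊆ T} (Π_{q ∈ T∖t} (−χ_q(w))) · D_d(t)`,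
`D_d(t) = Σ_b Λ(b.val/d) Π_{q ∈ t} χ_q(b)`: substitute `y ↦ w⁻¹y` and expand `Π_q (χ_q(y) − χ_q(w))`.
(The Taylor expansion of `σ_w⁻¹ · θ` in the variables `σ_q − 1`, Ota 2018, Prop. 3.3.)
[cite: Ota2018, Prop. 3.3] -/
theorem twistedSum_eq_sum_powerset {d : ℕ} [NeZero d] (χ : (d ℓ : ℕ) → (ZMod d)ˣ →* Multiplicative R)
    (w : (ZMod d)ˣ) (T : Finset ℕ) :
    ∑ y : (ZMod d)ˣ, Λ ((((w * y : (ZMod d)ˣ) : ZMod d).val : ℚ) / d) *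
        ∏ q ∈ T, Multiplicative.toAdd (χ d q y) =
      ∑ t ∈ T.powerset, (∏ q ∈ T \ t, -Multiplicative.toAdd (χ d q w)) *
        ∑ b : (ZMod d)ˣ, Λ (((b : ZMod d).val : ℚ) / d) * ∏ q ∈ t, Multiplicative.toAdd (χ d q b) := by
  classical
  have hfac : ∀ (q : ℕ) (y : (ZMod d)ˣ), Multiplicative.toAdd (χ d q (w⁻¹ * y)) =
      Multiplicative.toAdd (χ d q y) + -Multiplicative.toAdd (χ d q w) := by
    intro q y
    rw [map_mul, map_inv, toAdd_mul, toAdd_inv]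
    ring
  calc ∑ y : (ZMod d)ˣ, Λ ((((w * y : (ZMod d)ˣ) : ZMod d).val : ℚ) / d) *
        ∏ q ∈ T, Multiplicative.toAdd (χ d q y)
      = ∑ y : (ZMod d)ˣ, Λ (((y : ZMod d).val : ℚ) / d) *
          ∏ q ∈ T, Multiplicative.toAdd (χ d q (w⁻¹ * y)) := by
        refine Fintype.sum_equiv (Equiv.mulLeft w) _ _ fun y => ?_
        simp only [Equiv.coe_mulLeft, inv_mul_cancel_left]
    _ = ∑ y : (ZMod d)ˣ, ∑ t ∈ T.powerset, (∏ q ∈ T \ t, -Multiplicative.toAdd (χ d q w)) *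
          (Λ (((y : ZMod d).val : ℚ) / d) * ∏ q ∈ t, Multiplicative.toAdd (χ d q y)) := by
        refine Finset.sum_congr rfl fun y _ => ?_
        rw [Finset.prod_congr rfl (fun q _ => hfac q y), Finset.prod_add, Finset.mul_sum]
        refine Finset.sum_congr rfl fun t _ => ?_
        ring
    _ = ∑ t ∈ T.powerset, (∏ q ∈ T \ t, -Multiplicative.toAdd (χ d q w)) *
          ∑ b : (ZMod d)ˣ, Λ (((b : ZMod d).val : ℚ) / d) *
            ∏ q ∈ t, Multiplicative.toAdd (χ d q b) := by
        rw [Finset.sum_comm]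
        refine Finset.sum_congr rfl fun t _ => ?_
        rw [Finset.mul_sum]

/-- If the lower sums `D_d(t)`, `t ⊊ T`, vanish, then the twisted sum `Σ_y Λ((wy).val/d) Π_{q ∈ T} χ_q(y)`
is just `D_d(T)` (only `t = T` survives in `twistedSum_eq_sum_powerset`). [folklore] -/
private theorem twistedSum_eq_of_lower_eq_zero {d : ℕ} [NeZero d]
    (χ : (d ℓ : ℕ) → (ZMod d)ˣ →* Multiplicative R) (w : (ZMod d)ˣ) (T : Finset ℕ)
    (h0 : ∀ t ∈ T.powerset, t ≠ T →
      ∑ b : (ZMod d)ˣ, Λ (((b : ZMod d).val : ℚ) / d) * ∏ q ∈ t, Multiplicative.toAdd (χ d q b) = 0) :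
    ∑ y : (ZMod d)ˣ, Λ ((((w * y : (ZMod d)ˣ) : ZMod d).val : ℚ) / d) *
        ∏ q ∈ T, Multiplicative.toAdd (χ d q y) =
      ∑ b : (ZMod d)ˣ, Λ (((b : ZMod d).val : ℚ) / d) * ∏ q ∈ T, Multiplicative.toAdd (χ d q b) := by
  classical
  rw [twistedSum_eq_sum_powerset, Finset.sum_eq_single_of_mem T (Finset.mem_powerset.mpr le_rfl)
    (fun t ht hne => by rw [h0 t ht hne, mul_zero]), Finset.sdiff_self, Finset.prod_empty, one_mul]

/-- **`D_{ℓm}(T) = a_ℓ D_m(T) − E_m(T; ℓ) − E_m(T; ℓ⁻¹)` for `T ⊆ primes(m)`**: the norm relation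
`sum_fiber_symbol_eq` summed against the characters `Π_{q ∈ T} χ_q`, which are compatible with the
restriction `(ℤ/ℓm)ˣ → (ℤ/m)ˣ` (hypothesis `hχ`) (Mazur–Tate 1987, §1.3; Kim 2022, §3.5: the image of
`θ_{ℚ(μ_{nℓ})}` in `ℤ_p[Gal(ℚ(μ_n)/ℚ)]` is `(a_ℓ − σ_ℓ − σ_ℓ⁻¹) θ_{ℚ(μ_n)}`). [cite: MazurTate1987, §1.3] -/
theorem kuriharaSum_mul_level_eq (hP : ∀ (r : ℚ) (z : ℤ), Λ (r + z) = Λ r) (hℓ : ℓ.Prime)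
    (hℓm : ¬ ℓ ∣ m) (a : R)
    (hH : ∀ v : ℤ, a * Λ ((v : ℚ) / m) =
      ∑ j : Fin ℓ, Λ (((v : ℚ) / m + ((j : ℕ) : ℚ)) / ℓ) + Λ ((ℓ : ℚ) * ((v : ℚ) / m)))
    (u : (ZMod m)ˣ) (hu : (u : ZMod m) = ℓ) (χ : (d ℓ : ℕ) → (ZMod d)ˣ →* Multiplicative R)
    (T : Finset ℕ)
    (hχ : ∀ q ∈ T, ∀ b : (ZMod (ℓ * m))ˣ, χ (ℓ * m) q b = χ m q (ZMod.unitsMap (dvd_mul_left m ℓ) b)) :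
    ∑ b : (ZMod (ℓ * m))ˣ, Λ (((b : ZMod (ℓ * m)).val : ℚ) / ((ℓ * m : ℕ) : ℚ)) *
        ∏ q ∈ T, Multiplicative.toAdd (χ (ℓ * m) q b) =
      a * ∑ b : (ZMod m)ˣ, Λ (((b : ZMod m).val : ℚ) / m) * ∏ q ∈ T, Multiplicative.toAdd (χ m q b)
      - ∑ y : (ZMod m)ˣ, Λ ((((u * y : (ZMod m)ˣ) : ZMod m).val : ℚ) / m) *
          ∏ q ∈ T, Multiplicative.toAdd (χ m q y)
      - ∑ y : (ZMod m)ˣ, Λ ((((u⁻¹ * y : (ZMod m)ˣ) : ZMod m).val : ℚ) / m) *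
          ∏ q ∈ T, Multiplicative.toAdd (χ m q y) := by
  classical
  have hchar : ∀ b : (ZMod (ℓ * m))ˣ, ∏ q ∈ T, Multiplicative.toAdd (χ (ℓ * m) q b) =
      ∏ q ∈ T, Multiplicative.toAdd (χ m q (ZMod.unitsMap (dvd_mul_left m ℓ) b)) :=
    fun b => Finset.prod_congr rfl fun q hq => by rw [hχ q hq b]
  calc ∑ b : (ZMod (ℓ * m))ˣ, Λ (((b : ZMod (ℓ * m)).val : ℚ) / ((ℓ * m : ℕ) : ℚ)) *
        ∏ q ∈ T, Multiplicative.toAdd (χ (ℓ * m) q b)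
      = ∑ b : (ZMod (ℓ * m))ˣ, Λ (((b : ZMod (ℓ * m)).val : ℚ) / ((ℓ * m : ℕ) : ℚ)) *
          ∏ q ∈ T, Multiplicative.toAdd (χ m q (ZMod.unitsMap (dvd_mul_left m ℓ) b)) :=
        Finset.sum_congr rfl fun b _ => by rw [hchar]
    _ = ∑ x : (ZMod m)ˣ, ∑ b ∈ Finset.univ.filter
          (fun b : (ZMod (ℓ * m))ˣ => ZMod.unitsMap (dvd_mul_left m ℓ) b = x),
          Λ (((b : ZMod (ℓ * m)).val : ℚ) / ((ℓ * m : ℕ) : ℚ)) *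
            ∏ q ∈ T, Multiplicative.toAdd (χ m q (ZMod.unitsMap (dvd_mul_left m ℓ) b)) :=
        (Finset.sum_fiberwise Finset.univ (fun b => ZMod.unitsMap (dvd_mul_left m ℓ) b) _).symm
    _ = ∑ x : (ZMod m)ˣ, (∑ b ∈ Finset.univ.filter
          (fun b : (ZMod (ℓ * m))ˣ => ZMod.unitsMap (dvd_mul_left m ℓ) b = x),
          Λ (((b : ZMod (ℓ * m)).val : ℚ) / ((ℓ * m : ℕ) : ℚ))) *
            ∏ q ∈ T, Multiplicative.toAdd (χ m q x) := by
        refine Finset.sum_congr rfl fun x _ => ?_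
        rw [Finset.sum_mul]
        refine Finset.sum_congr rfl fun b hb => ?_
        rw [(Finset.mem_filter.mp hb).2]
    _ = ∑ x : (ZMod m)ˣ, (a * Λ (((x : ZMod m).val : ℚ) / m)
          - Λ ((((u * x : (ZMod m)ˣ) : ZMod m).val : ℚ) / m)
          - Λ ((((u⁻¹ * x : (ZMod m)ˣ) : ZMod m).val : ℚ) / m)) *
            ∏ q ∈ T, Multiplicative.toAdd (χ m q x) := by
        refine Finset.sum_congr rfl fun x _ => ?_
        rw [sum_fiber_symbol_eq hP hℓ hℓm a hH u hu x]
    _ = _ := by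
        simp only [sub_mul, Finset.sum_sub_distrib, Finset.mul_sum, mul_assoc]

end Fiber

/-! ### The lower Taylor coefficients vanish at Kolyvagin levels -/

section Vanishing

/-- **Vanishing of the lower Kurihara sums.** Let `n` be square-free, `χ d q` a family of additive
characters of `(ℤ/d)ˣ` compatible with the restrictions `(ℤ/d)ˣ → (ℤ/m)ˣ` (`m ∣ d`, `q ∣ m`), and
suppose that for every prime `ℓ ∣ n` the symbol satisfies the Hecke relation at the levels `d ∣ n`
prime to `ℓ` with `a_ℓ = 2` in `R` (at a Kolyvagin prime `a_ℓ ≡ ℓ + 1 ≡ 2 (mod p^k)`, Kim 2022, §1.2.2).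
Then for every level `d ∣ n` and every PROPER subset `T ⊊ primes(d)`, `D_d(T) = 0`: choosing
`ℓ ∈ primes(d) ∖ T`, `d = ℓm`, one has `D_d(T) = (a_ℓ − 2) D_m(T) − Σ_{t ⊊ T} (…) D_m(t)`
(`kuriharaSum_mul_level_eq`, `twistedSum_eq_sum_powerset`) and induction on `d` applies. This is the
statement that the Mazur–Tate element `θ_{ℚ(μ_n)}` has no Taylor terms of degree `< ν(n)` modulo `p^k`,
Kim 2022, §3.5: "`θ_{ℚ(μ_n)}(E) ≡ δ̃_n · Π_i (σ_{η_{ℓ_i}} − 1) mod (I_n, (σ_{η_{ℓ_1}} − 1)², …)`".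
[cite: Kim2022StructureSelmer, §3.5 (PDF p. 19)] -/
theorem kuriharaSum_eq_zero_of_ssubset (hP : ∀ (r : ℚ) (z : ℤ), Λ (r + z) = Λ r) {n : ℕ}
    (hn : Squarefree n)
    (hH : ∀ ℓ ∈ n.primeFactors, ∀ d : ℕ, d ∣ n → ¬ ℓ ∣ d → ∀ v : ℤ,
      (2 : R) * Λ ((v : ℚ) / d) =
        ∑ j : Fin ℓ, Λ (((v : ℚ) / d + ((j : ℕ) : ℚ)) / ℓ) + Λ ((ℓ : ℚ) * ((v : ℚ) / d)))
    (χ : (d ℓ : ℕ) → (ZMod d)ˣ →* Multiplicative R)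
    (hχ : ∀ {d m q : ℕ} (hm : m ∣ d), q ∣ m → ∀ b : (ZMod d)ˣ,
      χ d q b = χ m q (ZMod.unitsMap hm b))
    (d : ℕ) [NeZero d] (hd : d ∣ n) (T : Finset ℕ) (hT : T ⊂ d.primeFactors) :
    ∑ b : (ZMod d)ˣ, Λ (((b : ZMod d).val : ℚ) / d) * ∏ q ∈ T, Multiplicative.toAdd (χ d q b) = 0 := by
  classical
  -- strong induction on the level, the instance `NeZero d` travelling inside the predicate
  suffices h : ∀ d : ℕ, ∀ [NeZero d], d ∣ n → ∀ T : Finset ℕ, T ⊂ d.primeFactors →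
      ∑ b : (ZMod d)ˣ, Λ (((b : ZMod d).val : ℚ) / d) *
        ∏ q ∈ T, Multiplicative.toAdd (χ d q b) = 0 from h d hd T hT
  intro d
  induction d using Nat.strong_induction_on with
  | _ d ih =>
  intro _ hd T hT
  obtain ⟨ℓ₀, hℓ₀d, hℓ₀T⟩ := Finset.exists_of_ssubset hT
  have hℓ₀ : ℓ₀.Prime := Nat.prime_of_mem_primeFactors hℓ₀d
  obtain ⟨m, rfl⟩ := Nat.dvd_of_mem_primeFactors hℓ₀d
  have hm0 : m ≠ 0 := (Nat.mul_ne_zero_iff.mp (NeZero.ne (ℓ₀ * m))).2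
  haveI : NeZero m := ⟨hm0⟩
  have hsq : Squarefree (ℓ₀ * m) := Squarefree.squarefree_of_dvd hd hn
  have hℓ₀m : ¬ ℓ₀ ∣ m := by
    intro h
    have hunit : IsUnit ℓ₀ := hsq ℓ₀ (mul_dvd_mul_left ℓ₀ h)
    exact hℓ₀.one_lt.ne' (Nat.isUnit_iff.mp hunit)
  have hmn : m ∣ n := (dvd_mul_left m ℓ₀).trans hd
  have hℓ₀n : ℓ₀ ∈ n.primeFactors := Nat.primeFactors_mono hd hn.ne_zero hℓ₀d
  have hTm : T ⊆ m.primeFactors := by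
    intro q hq
    have hq' := hT.1 hq
    rw [Nat.primeFactors_mul hℓ₀.ne_zero hm0, hℓ₀.primeFactors, Finset.mem_union,
      Finset.mem_singleton] at hq'
    rcases hq' with rfl | h
    · exact absurd hq hℓ₀T
    · exact h
  have hcop : Nat.Coprime ℓ₀ m := (Nat.Prime.coprime_iff_not_dvd hℓ₀).mpr hℓ₀m
  have hlt : m < ℓ₀ * m := lt_mul_of_one_lt_left (Nat.pos_of_ne_zero hm0) hℓ₀.one_lt
  have hlow : ∀ t ∈ T.powerset, t ≠ T →
      ∑ b : (ZMod m)ˣ, Λ (((b : ZMod m).val : ℚ) / m) *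
        ∏ q ∈ t, Multiplicative.toAdd (χ m q b) = 0 := fun t ht hne =>
    ih m hlt hmn t (lt_of_lt_of_le (lt_of_le_of_ne (Finset.mem_powerset.mp ht) hne) hTm)
  rw [kuriharaSum_mul_level_eq hP hℓ₀ hℓ₀m 2 (hH ℓ₀ hℓ₀n m hmn hℓ₀m) (ZMod.unitOfCoprime ℓ₀ hcop)
      (ZMod.coe_unitOfCoprime ℓ₀ hcop) χ T
      (fun q hq b => hχ (dvd_mul_left m ℓ₀) (Nat.dvd_of_mem_primeFactors (hTm hq)) b),
    twistedSum_eq_of_lower_eq_zero χ _ T hlow, twistedSum_eq_of_lower_eq_zero χ _ T hlow]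
  ring

end Vanishing

/-! ### (F): the functional equation `δ_n = σ (−1)^{ν(n)} δ_n` -/

section FunctionalEquation

/-- **The functional equation of the Kurihara number** (Kim, Amer. J. Math. 148 (2026), §3.5,
eq. (3.3): "`w(E)·(−1)^{ν(n)}·δ̃_n = δ̃_n`"; Kurihara 2014, proof of Lemma 5.2.1; Kim 2025, eq. (2.1);
from Mazur–Tate 1987, (1.6.2)). Let `n` be square-free and prime to `N`, `Λ` a `1`-periodic symbol
with the Hecke relations (`a_ℓ = 2`) of `kuriharaSum_eq_zero_of_ssubset`, `χ` a compatible family of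
additive characters, and assume the Fricke symmetry `Λ(u/n) = σ Λ(v/n)` whenever `a n − u N v = 1`.
Then `δ_n = σ·(−1)^{ν(n)}·δ_n` for `δ_n = D_n(primes n) = Σ_{b ∈ (ℤ/n)ˣ} Λ(b.val/n) Π_{q ∣ n} χ_q(b)`:
substituting `b ↦ (−N)⁻¹ b⁻¹` (an involution of `(ℤ/n)ˣ`) and expanding
`Π_q χ_q((−N)⁻¹b⁻¹) = Π_q (χ_q((−N)⁻¹) − χ_q(b))`, the top term is `(−1)^{ν(n)} δ_n` and the others are
lower sums, which vanish. [cite: Kim2022StructureSelmer, §3.5 eq. (3.3) (PDF p. 19)]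
[cite: MazurTate1987, (1.6.2)] -/
theorem kuriharaSum_primeFactors_eq_sign_mul (hP : ∀ (r : ℚ) (z : ℤ), Λ (r + z) = Λ r) {n : ℕ}
    [NeZero n] (hn : Squarefree n)
    (hH : ∀ ℓ ∈ n.primeFactors, ∀ d : ℕ, d ∣ n → ¬ ℓ ∣ d → ∀ v : ℤ,
      (2 : R) * Λ ((v : ℚ) / d) =
        ∑ j : Fin ℓ, Λ (((v : ℚ) / d + ((j : ℕ) : ℚ)) / ℓ) + Λ ((ℓ : ℚ) * ((v : ℚ) / d)))
    (χ : (d ℓ : ℕ) → (ZMod d)ˣ →* Multiplicative R)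
    (hχ : ∀ {d m q : ℕ} (hm : m ∣ d), q ∣ m → ∀ b : (ZMod d)ˣ,
      χ d q b = χ m q (ZMod.unitsMap hm b))
    {N : ℕ} (hnN : Nat.Coprime N n) {σ : R}
    (hF : ∀ a u v : ℤ, a * n - u * (N * v) = 1 → Λ ((u : ℚ) / n) = σ * Λ ((v : ℚ) / n)) :
    ∑ b : (ZMod n)ˣ, Λ (((b : ZMod n).val : ℚ) / n) *
        ∏ q ∈ n.primeFactors, Multiplicative.toAdd (χ n q b) =
      σ * (-1) ^ n.primeFactors.card *
        ∑ b : (ZMod n)ˣ, Λ (((b : ZMod n).val : ℚ) / n) *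
          ∏ q ∈ n.primeFactors, Multiplicative.toAdd (χ n q b) := by
  classical
  -- `g₀ = (−N)⁻¹ ∈ (ℤ/n)ˣ` and the pointwise Fricke symmetry `Λ(b/n) = σ Λ(g₀ b⁻¹/n)`
  obtain ⟨g₀, hg₀⟩ : ∃ g₀ : (ZMod n)ˣ, g₀ = -(ZMod.unitOfCoprime N hnN)⁻¹ := ⟨_, rfl⟩
  have hFb : ∀ b : (ZMod n)ˣ, Λ (((b : ZMod n).val : ℚ) / n) =
      σ * Λ ((((g₀ * b⁻¹ : (ZMod n)ˣ) : ZMod n).val : ℚ) / n) := by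
    intro b
    have key' : ((b : (ZMod n)ˣ) : ZMod n) * ((N : ZMod n) * ((g₀ * b⁻¹ : (ZMod n)ˣ) : ZMod n))
        + 1 = 0 := by
      have h1 : ((ZMod.unitOfCoprime N hnN : (ZMod n)ˣ) : ZMod n) *
          (((ZMod.unitOfCoprime N hnN)⁻¹ : (ZMod n)ˣ) : ZMod n) = 1 := Units.mul_inv _
      have h2 : ((b : (ZMod n)ˣ) : ZMod n) * ((b⁻¹ : (ZMod n)ˣ) : ZMod n) = 1 := Units.mul_inv _
      rw [← ZMod.coe_unitOfCoprime N hnN, hg₀, Units.val_mul, Units.val_neg]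
      linear_combination (-(((b : (ZMod n)ˣ) : ZMod n) * ((b⁻¹ : (ZMod n)ˣ) : ZMod n))) * h1 - h2
    have key : ((((b : ZMod n).val : ℤ) * ((N : ℤ) * (((g₀ * b⁻¹ : (ZMod n)ˣ) : ZMod n).val : ℤ))
        + 1 : ℤ) : ZMod n) = 0 := by
      simp only [Int.cast_add, Int.cast_mul, Int.cast_one, Int.cast_natCast, ZMod.natCast_zmod_val]
      exact key'
    obtain ⟨c, hc⟩ := (ZMod.intCast_zmod_eq_zero_iff_dvd _ n).mp key
    have h := hF c ((b : ZMod n).val : ℤ) ((((g₀ * b⁻¹ : (ZMod n)ˣ) : ZMod n).val : ℤ))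
      (by linear_combination -hc)
    push_cast at h
    exact h
  -- the involution `b ↦ g₀ b⁻¹`
  have hinv' : ∀ b : (ZMod n)ˣ, g₀ * (g₀ * b⁻¹)⁻¹ = b := by
    intro b
    rw [mul_inv_rev, inv_inv, mul_comm b, ← mul_assoc, mul_inv_cancel, one_mul]
  have hinv : Function.Involutive (fun b : (ZMod n)ˣ => g₀ * b⁻¹) := hinv'
  -- expansion of the characters at `g₀ b⁻¹`
  have hfac : ∀ (q : ℕ) (b : (ZMod n)ˣ), Multiplicative.toAdd (χ n q (g₀ * b⁻¹)) =
      -Multiplicative.toAdd (χ n q b) + Multiplicative.toAdd (χ n q g₀) := by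
    intro q b
    rw [map_mul, map_inv, toAdd_mul, toAdd_inv]
    ring
  have hneg : ∀ (t : Finset ℕ) (b : (ZMod n)ˣ), ∏ q ∈ t, -Multiplicative.toAdd (χ n q b) =
      (-1) ^ t.card * ∏ q ∈ t, Multiplicative.toAdd (χ n q b) := by
    intro t b
    rw [Finset.prod_congr rfl (fun q _ => neg_eq_neg_one_mul (Multiplicative.toAdd (χ n q b))),
      Finset.prod_mul_distrib, Finset.prod_const]
  have hlow : ∀ t ∈ n.primeFactors.powerset, t ≠ n.primeFactors →
      ∑ b : (ZMod n)ˣ, Λ (((b : ZMod n).val : ℚ) / n) * ∏ q ∈ t, Multiplicative.toAdd (χ n q b) = 0 :=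
    fun t ht hne => kuriharaSum_eq_zero_of_ssubset hP hn hH χ hχ n dvd_rfl t
      (lt_of_le_of_ne (Finset.mem_powerset.mp ht) hne)
  calc ∑ b : (ZMod n)ˣ, Λ (((b : ZMod n).val : ℚ) / n) *
        ∏ q ∈ n.primeFactors, Multiplicative.toAdd (χ n q b)
      = ∑ b : (ZMod n)ˣ, σ * Λ ((((g₀ * b⁻¹ : (ZMod n)ˣ) : ZMod n).val : ℚ) / n) *
          ∏ q ∈ n.primeFactors, Multiplicative.toAdd (χ n q b) := by
        exact Finset.sum_congr rfl fun b _ => by rw [hFb b]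
    _ = ∑ b : (ZMod n)ˣ, σ * Λ (((b : ZMod n).val : ℚ) / n) *
          ∏ q ∈ n.primeFactors, Multiplicative.toAdd (χ n q (g₀ * b⁻¹)) := by
        refine Fintype.sum_equiv (Function.Involutive.toPerm _ hinv) _ _ fun b => ?_
        simp only [Function.Involutive.coe_toPerm]
        rw [hinv' b]
    _ = ∑ b : (ZMod n)ˣ, ∑ t ∈ n.primeFactors.powerset,
          σ * ((-1) ^ t.card * ∏ q ∈ n.primeFactors \ t, Multiplicative.toAdd (χ n q g₀)) *
            (Λ (((b : ZMod n).val : ℚ) / n) * ∏ q ∈ t, Multiplicative.toAdd (χ n q b)) := by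
        refine Finset.sum_congr rfl fun b _ => ?_
        rw [Finset.prod_congr rfl (fun q _ => hfac q b), Finset.prod_add, Finset.mul_sum]
        refine Finset.sum_congr rfl fun t _ => ?_
        rw [hneg t b]
        ring
    _ = ∑ t ∈ n.primeFactors.powerset,
          σ * ((-1) ^ t.card * ∏ q ∈ n.primeFactors \ t, Multiplicative.toAdd (χ n q g₀)) *
            ∑ b : (ZMod n)ˣ, Λ (((b : ZMod n).val : ℚ) / n) *
              ∏ q ∈ t, Multiplicative.toAdd (χ n q b) := by
        rw [Finset.sum_comm]
        refine Finset.sum_congr rfl fun t _ => ?_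
        rw [Finset.mul_sum]
    _ = σ * (-1) ^ n.primeFactors.card *
          ∑ b : (ZMod n)ˣ, Λ (((b : ZMod n).val : ℚ) / n) *
            ∏ q ∈ n.primeFactors, Multiplicative.toAdd (χ n q b) := by
        rw [Finset.sum_eq_single_of_mem n.primeFactors (Finset.mem_powerset.mpr le_rfl)
          (fun t ht hne => by rw [hlow t ht hne, mul_zero]), Finset.sdiff_self, Finset.prod_empty,
          mul_one]

/-- **Parity vanishing of the Kurihara number** (Kim, Amer. J. Math. 148 (2026), Prop. 3.14 (journal)
= arXiv v3 Prop. 3.16: "If `(−1)^{ν(n)} ≠ w(E)`, then `δ̃_n = 0`"; Kurihara 2014, Lemma 5.2.1; Kim 2025,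
Prop. 2.5): under the hypotheses of `kuriharaSum_primeFactors_eq_sign_mul`, if `σ·(−1)^{ν(n)} = −1` and
`2` is invertible in `R` (e.g. `R = ℤ/p^k`, `p` odd), then `δ_n = 0` (`δ_n = −δ_n` forces `2δ_n = 0`).
[cite: Kim2022StructureSelmer, Prop. 3.14 (journal) = arXiv v3 Prop. 3.16 (PDF p. 19)]
[cite: Kurihara2014, Lemma 5.2.1] -/
theorem kuriharaSum_primeFactors_eq_zero (hP : ∀ (r : ℚ) (z : ℤ), Λ (r + z) = Λ r) {n : ℕ}
    [NeZero n] (hn : Squarefree n)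
    (hH : ∀ ℓ ∈ n.primeFactors, ∀ d : ℕ, d ∣ n → ¬ ℓ ∣ d → ∀ v : ℤ,
      (2 : R) * Λ ((v : ℚ) / d) =
        ∑ j : Fin ℓ, Λ (((v : ℚ) / d + ((j : ℕ) : ℚ)) / ℓ) + Λ ((ℓ : ℚ) * ((v : ℚ) / d)))
    (χ : (d ℓ : ℕ) → (ZMod d)ˣ →* Multiplicative R)
    (hχ : ∀ {d m q : ℕ} (hm : m ∣ d), q ∣ m → ∀ b : (ZMod d)ˣ,
      χ d q b = χ m q (ZMod.unitsMap hm b))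
    {N : ℕ} (hnN : Nat.Coprime N n) {σ : R}
    (hF : ∀ a u v : ℤ, a * n - u * (N * v) = 1 → Λ ((u : ℚ) / n) = σ * Λ ((v : ℚ) / n))
    (hsign : σ * (-1) ^ n.primeFactors.card = -1) (h2 : IsUnit (2 : R)) :
    ∑ b : (ZMod n)ˣ, Λ (((b : ZMod n).val : ℚ) / n) *
        ∏ q ∈ n.primeFactors, Multiplicative.toAdd (χ n q b) = 0 := by
  have h := kuriharaSum_primeFactors_eq_sign_mul hP hn hH χ hχ hnN hF
  rw [hsign] at h
  have h' : (2 : R) * ∑ b : (ZMod n)ˣ, Λ (((b : ZMod n).val : ℚ) / n) *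
      ∏ q ∈ n.primeFactors, Multiplicative.toAdd (χ n q b) = 0 := by
    linear_combination h
  exact (h2.mul_right_eq_zero).mp h'

end FunctionalEquation

end Literature.NumberTheory.EllipticCurves.MazurTate

end
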